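import Summits.CriticalPhenomena.PercolationContinuityZ3.Theorems.PercNearOneGluingNoHeavyQuantCatHullTableSem
import HarnessLib

/-!
# QUANT lane R8, T-DEC: CORE LEMMAS FOR THE EXACT `leaf` CHECK — the quadratic sign test on an interval, nonnegative vertex combinations on boxes
# of dimension ≤ 3, the unit-box parametrisation of the tiny regions, and a kd-tree box verifier with its covering lemma

builds on p205010 (kernel theorem, internal audit signed; external expert review pending)

Support file (`--supports stmt-CriticalPhenomena-4575`), QUANT lane census seat prim-quant-census-2 (gen 78).  Definitions + theorems; standard axioms,
no sorries.  Instance-independent pieces of the `leaf` layer of census-2 g78's kernel certificate (memo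
`run/shared/lean/prim/quant/prim-quant-census-2-g78/BELLMAN-G78.md` §3): a leaf inequality `LHS(G,t) ≤ piece(G, A(G,t))` is MULTILINEAR in the box
parameters `t ∈ [0,1]ⁿ` (`n ≤ 3`), so on a box inside one `A`-cell it holds iff it holds at the `2ⁿ` vertices (`box_nonneg₁/₂/₃`, given the multilinear
interpolation identity, which `ring` supplies per leaf); at a vertex both sides are `G·(quadratic in y/G)`, so the inequality on a `G`-interval is the sign
of a quadratic (`quadOK`, `quadOK_sound`); `unitParam` turns `x ≤ g ≤ 1` into `g = x + (1 − x)·t`, `t ∈ [0,1]`; `KD`/`KD.run`/`KD.run_sound` replay a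
kd-tree of midpoint bisections found offline and conclude on the whole root box.  [this work].  Nothing here is cited as a published result.  The gluing rows
served [cite: KozmaNitzan2024, Conjecture 3 (p. 15)]; product measure [cite: Grimmett1999, §1.3 p. 10].
-/

noncomputable section

namespace Summit.CriticalPhenomena.PercolationContinuityZ3.Theorems
namespace Quant
namespace LawDec
namespace Tab

/-! ### The quadratic sign test on an interval -/

/-- evaluation of `e1 G² + e0 G + e2`. [this work] -/
def qev (e1 e0 e2 G : ℚ) : ℚ := (e1 * G + e0) * G + e2

/-- **exact test** for `e1 G² + e0 G + e2 ≥ 0` on `[G0, G1]`: both ends, and the vertex when the parabola is convex with vertex inside. [this work] -/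
def quadOK (e1 e0 e2 G0 G1 : ℚ) : Bool :=
  decide (0 ≤ qev e1 e0 e2 G0) && decide (0 ≤ qev e1 e0 e2 G1) &&
    (decide (e1 ≤ 0) || decide (2 * e1 * G0 + e0 ≥ 0) || decide (2 * e1 * G1 + e0 ≤ 0) || decide (0 ≤ 4 * e1 * e2 - e0 * e0))

/-- **soundness of the quadratic test.** [this work] -/
theorem quadOK_sound {e1 e0 e2 G0 G1 : ℚ} (h : quadOK e1 e0 e2 G0 G1 = true) {G : ℝ} (h0 : (G0 : ℝ) ≤ G) (h1 : G ≤ G1) :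
    0 ≤ (e1 : ℝ) * G ^ 2 + e0 * G + e2 := by
  unfold quadOK qev at h
  simp only [Bool.and_eq_true, Bool.or_eq_true, decide_eq_true_eq] at h
  obtain ⟨⟨q0, q1⟩, hv⟩ := h
  have q0' : (0 : ℝ) ≤ (e1 * G0 + e0) * G0 + e2 := by exact_mod_cast q0
  have q1' : (0 : ℝ) ≤ (e1 * G1 + e0) * G1 + e2 := by exact_mod_cast q1
  by_cases hc : (e1 : ℝ) ≤ 0
  · -- concave: the graph lies above the chord; (G1-G0) q(G) = (G1-G) q(G0) + (G-G0) q(G1) - e1 (G-G0)(G1-G)(G1-G0)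
    have hprod : 0 ≤ ((G1 : ℝ) - G0) * (e1 * G ^ 2 + e0 * G + e2) := by
      have i : ((G1 : ℝ) - G0) * (e1 * G ^ 2 + e0 * G + e2)
          = (G1 - G) * ((e1 * G0 + e0) * G0 + e2) + (G - G0) * ((e1 * G1 + e0) * G1 + e2) + (-e1) * ((G - G0) * (G1 - G) * (G1 - G0)) := by ring
      rw [i]
      have t3 : 0 ≤ (-(e1 : ℝ)) * ((G - G0) * (G1 - G) * (G1 - G0)) :=
        mul_nonneg (neg_nonneg.2 hc) (mul_nonneg (mul_nonneg (sub_nonneg.2 h0) (sub_nonneg.2 h1)) (by linarith))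
      nlinarith [mul_nonneg (sub_nonneg.2 h1) q0', mul_nonneg (sub_nonneg.2 h0) q1']
    rcases lt_or_eq_of_le (h0.trans h1) with hlt | heq
    · exact (mul_nonneg_iff_of_pos_left (sub_pos.2 hlt)).1 hprod
    · have hG : G = G0 := le_antisymm (by rw [heq]; exact h1) h0
      rw [hG]; nlinarith
  · have he : (0 : ℝ) < e1 := lt_of_not_ge hc
    rcases hv with ((hc2 | hl) | hr) | hd
    · exact absurd (by exact_mod_cast hc2) hc
    · have hl' : (0 : ℝ) ≤ 2 * e1 * G0 + e0 := by exact_mod_cast hl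
      -- q(G) = q(G0) + (G-G0)(2 e1 G0 + e0) + e1 (G-G0)^2
      nlinarith [mul_nonneg (sub_nonneg.2 h0) hl', mul_nonneg he.le (sq_nonneg (G - G0))]
    · have hr' : (2 : ℝ) * e1 * G1 + e0 ≤ 0 := by exact_mod_cast hr
      -- q(G) = q(G1) - (G1-G)(2 e1 G1 + e0) + e1 (G1-G)^2
      nlinarith [mul_nonneg (sub_nonneg.2 h1) (neg_nonneg.2 hr'), mul_nonneg he.le (sq_nonneg (G1 - G))]
    · have hd' : (0 : ℝ) ≤ 4 * e1 * e2 - e0 * e0 := by exact_mod_cast hd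
      -- 4 e1 q(G) = (2 e1 G + e0)^2 + (4 e1 e2 - e0^2)
      nlinarith [sq_nonneg (2 * (e1 : ℝ) * G + e0)]

/-! ### Nonnegative vertex combinations on boxes (the multilinear vertex principle, given the interpolation identity) -/

/-- dimension 1: `f = (1 − t)·f₀ + t·f₁` with `t ∈ [0,1]`, `f₀, f₁ ≥ 0` ⟹ `f ≥ 0`. [this work] -/
theorem box_nonneg₁ {f f0 f1 t : ℝ} (h : f = (1 - t) * f0 + t * f1) (ht0 : 0 ≤ t) (ht1 : t ≤ 1) (h0 : 0 ≤ f0) (h1 : 0 ≤ f1) : 0 ≤ f := by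
  rw [h]; nlinarith [mul_nonneg ht0 h1, mul_nonneg (sub_nonneg.2 ht1) h0]

/-- dimension 2. [this work] -/
theorem box_nonneg₂ {f f00 f01 f10 f11 s t : ℝ}
    (h : f = (1 - s) * ((1 - t) * f00 + t * f01) + s * ((1 - t) * f10 + t * f11))
    (hs0 : 0 ≤ s) (hs1 : s ≤ 1) (ht0 : 0 ≤ t) (ht1 : t ≤ 1) (h00 : 0 ≤ f00) (h01 : 0 ≤ f01) (h10 : 0 ≤ f10) (h11 : 0 ≤ f11) : 0 ≤ f := by
  have a := box_nonneg₁ (f := (1 - t) * f00 + t * f01) rfl ht0 ht1 h00 h01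
  have b := box_nonneg₁ (f := (1 - t) * f10 + t * f11) rfl ht0 ht1 h10 h11
  exact box_nonneg₁ h hs0 hs1 a b

/-- dimension 3. [this work] -/
theorem box_nonneg₃ {f f000 f001 f010 f011 f100 f101 f110 f111 r s t : ℝ}
    (h : f = (1 - r) * ((1 - s) * ((1 - t) * f000 + t * f001) + s * ((1 - t) * f010 + t * f011)) +
             r * ((1 - s) * ((1 - t) * f100 + t * f101) + s * ((1 - t) * f110 + t * f111)))
    (hr0 : 0 ≤ r) (hr1 : r ≤ 1) (hs0 : 0 ≤ s) (hs1 : s ≤ 1) (ht0 : 0 ≤ t) (ht1 : t ≤ 1)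
    (h000 : 0 ≤ f000) (h001 : 0 ≤ f001) (h010 : 0 ≤ f010) (h011 : 0 ≤ f011)
    (h100 : 0 ≤ f100) (h101 : 0 ≤ f101) (h110 : 0 ≤ f110) (h111 : 0 ≤ f111) : 0 ≤ f := by
  have a := box_nonneg₂ (f := (1 - s) * ((1 - t) * f000 + t * f001) + s * ((1 - t) * f010 + t * f011)) rfl hs0 hs1 ht0 ht1 h000 h001 h010 h011
  have b := box_nonneg₂ (f := (1 - s) * ((1 - t) * f100 + t * f101) + s * ((1 - t) * f110 + t * f111)) rfl hs0 hs1 ht0 ht1 h100 h101 h110 h111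
  exact box_nonneg₁ h hr0 hr1 a b

/-! ### The unit-box parametrisation of the tiny regions -/

/-- `x ≤ g ≤ 1` with `x < 1` is `g = x + (1 − x)·t` for some `t ∈ [0,1]`. [this work] -/
theorem unitParam {x g : ℝ} (hx1 : x < 1) (hxg : x ≤ g) (hg1 : g ≤ 1) : ∃ t : ℝ, 0 ≤ t ∧ t ≤ 1 ∧ g = x + (1 - x) * t := by
  have hne : (1 : ℝ) - x ≠ 0 := (sub_pos.2 hx1).ne'
  refine ⟨(g - x) / (1 - x), div_nonneg (by linarith) (by linarith), ?_, ?_⟩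
  · rw [div_le_one (by linarith)]; linarith
  · rw [mul_div_cancel₀ _ hne]; ring

/-- `0 ≤ p1 ≤ 1 − p5` is `p1 = (1 − p5)·t` for some `t ∈ [0,1]` (when `p5 = 1`, `t = 0`). [this work] -/
theorem unitParam' {p1 p5 : ℝ} (h0 : 0 ≤ p1) (h1 : p1 + p5 ≤ 1) (hp5 : p5 ≤ 1) : ∃ t : ℝ, 0 ≤ t ∧ t ≤ 1 ∧ p1 = (1 - p5) * t := by
  rcases eq_or_lt_of_le hp5 with he | hlt
  · refine ⟨0, le_rfl, zero_le_one, ?_⟩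
    have : p1 = 0 := by linarith
    rw [this, he]; ring
  · have hne : (1 : ℝ) - p5 ≠ 0 := (sub_pos.2 hlt).ne'
    refine ⟨p1 / (1 - p5), div_nonneg h0 (by linarith), ?_, ?_⟩
    · rw [div_le_one (by linarith)]; linarith
    · rw [mul_div_cancel₀ _ hne]

/-! ### A kd-tree of midpoint bisections, replayed -/

/-- a box: a `G`-interval and up to three parameter intervals (unused ones are ignored by the predicate). [this work] -/
structure Box where
  g0 : ℚ
  g1 : ℚ
  lo : Fin 3 → ℚ
  hi : Fin 3 → ℚ

/-- a kd-tree: `leaf` (check the current box) or split dimension `d` (`0` = the `G`-interval, `i+1` = parameter `i`) at the midpoint. [this work] -/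
inductive KD where
  | leaf : KD
  | split : ℕ → KD → KD → KD

/-- the two halves of a box along dimension `d`. [this work] -/
def Box.halves (B : Box) (d : ℕ) : Box × Box :=
  if d = 0 then
    let m := (B.g0 + B.g1) / 2
    ({ B with g1 := m }, { B with g0 := m })
  else
    let i : Fin 3 := ⟨(d - 1) % 3, Nat.mod_lt _ (by norm_num)⟩
    let m := (B.lo i + B.hi i) / 2
    ({ B with hi := fun j => if j = i then m else B.hi j }, { B with lo := fun j => if j = i then m else B.lo j })

/-- replay a kd-tree against a box predicate. [this work] -/
def KD.run (ok : Box → Bool) : KD → Box → Bool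
  | KD.leaf, B => ok B
  | KD.split d L R, B => KD.run ok L (B.halves d).1 && KD.run ok R (B.halves d).2

/-- membership of a real point `(G, t)` in a box. [this work] -/
def Box.mem (B : Box) (G : ℝ) (t : Fin 3 → ℝ) : Prop :=
  (B.g0 : ℝ) ≤ G ∧ G ≤ B.g1 ∧ ∀ i, (B.lo i : ℝ) ≤ t i ∧ t i ≤ B.hi i

/-- a point of a box lies in one of its halves. [this work] -/
theorem Box.mem_halves (B : Box) (d : ℕ) {G : ℝ} {t : Fin 3 → ℝ} (h : B.mem G t) :
    (B.halves d).1.mem G t ∨ (B.halves d).2.mem G t := by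
  obtain ⟨hg0, hg1, ht⟩ := h
  unfold Box.halves
  by_cases hd : d = 0
  · simp only [hd, if_true]
    rcases le_total G (((B.g0 + B.g1) / 2 : ℚ) : ℝ) with hle | hge
    · exact Or.inl ⟨hg0, hle, ht⟩
    · exact Or.inr ⟨hge, hg1, ht⟩
  · simp only [hd, if_false]
    set i : Fin 3 := ⟨(d - 1) % 3, Nat.mod_lt _ (by norm_num)⟩
    rcases le_total (t i) (((B.lo i + B.hi i) / 2 : ℚ) : ℝ) with hle | hge
    · refine Or.inl ⟨hg0, hg1, fun j => ?_⟩
      by_cases hj : j = i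
      · subst hj; simp only [if_true]; exact ⟨(ht _).1, hle⟩
      · simp only [hj, if_false]; exact ht j
    · refine Or.inr ⟨hg0, hg1, fun j => ?_⟩
      by_cases hj : j = i
      · subst hj; simp only [if_true]; exact ⟨hge, (ht _).2⟩
      · simp only [hj, if_false]; exact ht j

/-- **soundness of the replay**: if the tree passes on `B` and `ok` is sound for a property `P` of points, then `P` holds on all of `B`. [this work] -/
theorem KD.run_sound {ok : Box → Bool} {P : ℝ → (Fin 3 → ℝ) → Prop} (hok : ∀ B, ok B = true → ∀ G t, B.mem G t → P G t) :
    ∀ (T : KD) (B : Box), KD.run ok T B = true → ∀ G t, B.mem G t → P G t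
  | KD.leaf, B, h, G, t, hm => hok B h G t hm
  | KD.split d L R, B, h, G, t, hm => by
    unfold KD.run at h; simp only [Bool.and_eq_true] at h
    rcases B.mem_halves d hm with h1 | h2
    · exact KD.run_sound hok L _ h.1 G t h1
    · exact KD.run_sound hok R _ h.2 G t h2

end Tab
end LawDec
end Quant
end Summit.CriticalPhenomena.PercolationContinuityZ3.Theorems
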